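import Summits.QuantumFields.YangMills.Theorems.BalabanUVNodesN06Row17LocalClauseAtFlat
import Literature.MathematicalPhysics.QuantumFieldTheory.Balaban1983to89.B6SectADeltaACoerciveReductionV1
import Literature.MathematicalPhysics.QuantumFieldTheory.Balaban1983to89.Node00.OpsYCurlGrad

/-!
# BalabanUVNodes ∕ N06 ([B9], `Dag.B9_main`) — ROW 17's LOCAL CENTRE NUMBER `m_□`: the coercivity of print's LOCAL bond operator `Δ_{a,□}(1)` at
# node00-def-Y's FILE 40 letters REDUCED TO THREE LOCAL LETTERS with an EXPLICIT constant — [4]'s axial-gauge road (dag-n10-c ROAD «C» station C1)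
# re-run for `Δ_{a,□}` with the local gauge projection `R_□`, in the rows' trace currency (the W0 half (b) of the road, reduction step)

Track A of `YM-PLAN.md` (cell `pub-ymgap`, HUMAN RULING D-0062), node **N06** = [Balaban1985BackgroundPropagators] Thms 3.1–3.15; seat `pub-ymgap-dag-n06-j`
(bundle F5, rows 15–17), g24.  A HELPER (count-neutral, `--supports` only).

THE PRINT.  [B9] p. 416 (proof of Thm 3.11): *«In [4] we have proved that the operator G_□(1) is positive»*; [4] = [Balaban1984PropagatorsII] p. 226:
*«One of our main results will be that the operator Δ_a is bounded from below by a positive constant»*, (2.19) `Δ_a = ∂*∂ + ∂R∂* + Q*aQ`, p. 227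
*«Because Q′λ′ = 0, hence QA^{λ′} = QA − ∂₁Q′λ′ = QA»*, (2.11) p. 225, Lemma 2.4 (2.128) p. 245, the axial gauge (2.121) p. 244; p. 239: *«otherwise the
operator G_□ is simply equal to the operator G_j on the torus T_□»*.

WHY THIS FILE.  The row-17 local road of record (`…N06Row17LocalClauseOnReg335OfL5Letters.posDefTr_padDeltaALocY_of_L5_of_regYP335`, g23) displays the
CENTRE NUMBER `hco : m·⟨Ψ,Ψ⟩₁ ≤ ⟨Ψ, padDeltaALocY … 1 Ψ⟩₁`; the tree had it qualitatively (`…LocalClauseAtFlat.posDefTr_padDeltaALocY_one`, g22: «no common zero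
mode»).  dag-n10-c's ROAD «C» station C1 (`B6SectADeltaACoerciveReductionV1`) reduced the GLOBAL `Δ_a` of the V1 model to three letters with an explicit
constant and isolated the norm arithmetic (`coercive_of_gauge_letters_abstract`, any normed groups).  THIS FILE re-runs that reduction for print's LOCAL
operator `Δ_{a,□}(1) = Δ(1) + D₁R_□(1)D*₁ + Q*aQ` (`OpsYDeltaALocal.deltaALocY` over the Dirichlet cube inverse `G′_□ = GsqY` on the cube site set `D`) at
def-Y's letters, in the trace currency `⟨·,·⟩₁ = trIP 1` of the rows, through the orthonormal coordinates `B9Thm311ReadingCoords.realify311`: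
* §1 the local bookkeeping at `U = 1` (the three facts the reduction needs about `D₁λ` for a gauge function `λ` with `Q′(1)λ = 0`):
  `qK_gradK_mulVec_of_qpK` ∕ ★ `QY_gradY_one_of_QpY` (`Q(1)D₁λ = 0` — p. 227, r03's `constr_zero_grad` through the chart, read entrywise), `curlY_gradY_one`
  (`∂₁D₁ = 0`), ★ `RlocY_one_divY_gradY_of_support` (`R_□(1)` FIXES `D*₁D₁λ` when `λ` is supported in `D`: g22's `G′_□(1)Δ′_a(1)λ = λ` + def-Y's
  `RlocY_apply_of_P_QpY_GsqY_eq_zero`);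
* §2 the divergence bound in the trace currency: `trIP_one_self_eq_sum_entries`, `sum_sq_divK_mulVec_le` (C1's `normSq_dsE_le` through the chart),
  ★ `trIP_divY_one_self_le` (`‖D*₁B‖²₁ ≤ 4(d+1)c_f²·⟨B,B⟩₁`);
* §3 ★★★ `coer_trIP_deltaALocY_one_of_letters` — **THE LOCAL REDUCTION**: if `A = B + D₁λ` with `Q′(1)λ = 0`, `λ` supported in `D`, a Lemma-2.4-shaped bound
  `κ·⟨B,B⟩₁ ≤ ‖∂₁B‖²₁ + ‖Q(1)B‖²_w` and a (2.11)-shaped bound `π·⟨λ,λ⟩₁ ≤ ⟨D₁λ, D₁λ⟩₁` (`κ, π > 0`), then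
  **`(2∕κ + (4∕π)(1 + 4(d+1)c_f²∕κ))⁻¹ · ⟨A,A⟩₁ ≤ ⟨A, Δ_{a,□}(1)A⟩₁`** (any 0∕1 block cut `χP`); ★★ `coer_trIP_deltaALocY_one_of_classes` (letters on classes
  `𝒯`, `𝒩` + decomposition); ★★★ `coer_trIP_padDeltaALocY_one_of_classes` — the PADDED operator of the road: **`min 1 γ · ⟨Ψ,Ψ⟩₁ ≤ ⟨Ψ, padDeltaALocY … (cutMulY χ) 1 Ψ⟩₁`
  for every `Ψ`**, i.e. the `hco` binder of `posDefTr_padDeltaALocY_of_L5_of_regYP335` with `m := min 1 γ`, from the three letters for the cut fields `M_χΨ`.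
WHAT REMAINS DISPLAYED (the W0 (b) letters, dag-n10-c census v22.1): the local Lemma-2.4 letter on the axially gauged class near `□̃` (C4 `lemma24_oneLevel_V1`
at the cube's level for one-level cubes with non-deeper neighbours), the (2.11) letter on `N(Q′(1))` (C3 `poincare211_V1` through the chart), and the
supported axial decomposition (C2 with base points in `□̃`).
HONEST FRAMING.  Finite-dimensional norm arithmetic at `U = 1`; the three letters are DISPLAYED hypotheses; nothing of [B9]'s or [4]'s estimates is asserted;
COUNT-NEUTRAL; N06 ∕ N10 NOT discharged; nothing continuum ∕ OS ∕ mass gap ∕ Clay.  0 `def`, 0 `sorry`.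
-/

noncomputable section

namespace Summit.QuantumFields.YangMills.BalabanUVNodes.N06Row17LocalCentreCoercive

open Literature.MathematicalPhysics.QuantumFieldTheory.Balaban1983to89
open Literature.MathematicalPhysics.QuantumFieldTheory.Balaban1983to89.Node00
open Literature.MathematicalPhysics.QuantumFieldTheory.Balaban1983to89.Node00.OpsYLocalInverse (GsqY cubeProjY)
open Literature.MathematicalPhysics.QuantumFieldTheory.Balaban1983to89.Node00.OpsYDeltaALocal (RlocY deltaALocY padDeltaALocY)
open Literature.MathematicalPhysics.QuantumFieldTheory.Balaban1983to89.Node00.OpsYDeltaALocalProj (RlocY_apply_of_P_QpY_GsqY_eq_zero)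
open Literature.MathematicalPhysics.QuantumFieldTheory.Balaban1983to89.B9Thm311ReadingCoords (trIP realify311 inner_realify311 norm_sq_realify311)
open Literature.MathematicalPhysics.QuantumFieldTheory.Balaban1983to89.B9Thm311DeltaPrimePos (trIP_self_nonneg trIP_self_pos trIP_add_right)
open Literature.MathematicalPhysics.QuantumFieldTheory.Balaban1983to89.B9Ineq349SiteAdjoint (trIP_comm)
open Literature.MathematicalPhysics.QuantumFieldTheory.Balaban1983to89.B9Thm311AdjointPairs (isAdjTr_gradY_divY)
open Literature.MathematicalPhysics.QuantumFieldTheory.Balaban1983to89.B9Thm311CoercivePureGaugeAtLettersY (trIP_hessY_eq_curl_of_flat)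
open Literature.MathematicalPhysics.QuantumFieldTheory.Balaban1983to89.B9Thm311PosViaLocalInversesY (trIP_dirPadY_cutMulY_eq cutMulY_mul_self_of_zero_one
  cutMulY_add_compl trIP_cutMulY_right_gen)
open Literature.MathematicalPhysics.QuantumFieldTheory.Balaban1983to89.B9Thm37CubeCoverCommutators (cutMulY cutMulY_apply cutMulY_mul)
open Literature.MathematicalPhysics.QuantumFieldTheory.Balaban1983to89.B9LocalGaugeZeroModesY (inGauge_iff_qpK_mulVec_eq_zero gradK_mulVec_chart
  qK_mulVec_eq_zero_iff)
open Literature.MathematicalPhysics.QuantumFieldTheory.Balaban1983to89.B6SectADeltaACoerciveReductionV1 (coercive_of_gauge_letters_abstract normSq_dsE_le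
  normSq_eq_sum_sq)
open Literature.MathematicalPhysics.QuantumFieldTheory.Balaban1983to89.B6KLevelCensusIndexV1 (KIdx)
open Literature.MathematicalPhysics.QuantumFieldTheory.Balaban1983to89.B6GlobalChartV1 (PV boxEquiv domT)
open Literature.MathematicalPhysics.QuantumFieldTheory.Balaban1983to89.B6Ineq2133TwoScaleV1 (onFun onFun_apply)
open Literature.MathematicalPhysics.QuantumFieldTheory.Balaban1983to89.B6SectAOperatorsV1 (dsE)
open OpsYNablaBridge (chartY)
open Summit.QuantumFields.YangMills.BalabanUVNodes.N06Row17LocalClauseAtFlat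
open scoped Matrix InnerProductSpace
open scoped Matrix.Norms.L2Operator

variable {N : ℕ} {d ℓ : ℕ} {hd : 1 ≤ d + 1} {hL : Odd (ℓ + 1) ∧ 1 < ℓ + 1} {b₀ b₁ : ℝ} (i : KIdx d ℓ hd hL b₀ b₁)

/-! ## §1 Local bookkeeping at `U = 1`: `Q(1)D₁λ = 0`, `∂₁D₁ = 0`, `R_□(1)` fixes `D*₁D₁λ` -/

/-- (real kernels) **«Because Q′λ = 0, hence Q∂λ = 0»**: `qK·(gradK·g) = 0` for `qpK·g = 0` — r03's `constr_zero_grad` through def-Y's chart.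
[cite: Balaban1984PropagatorsII, p.227 («QA^{λ′} = QA − ∂₁Q′λ′ = QA»), (2.7) p.224] -/
theorem qK_gradK_mulVec_of_qpK {g : SiteY i → ℝ} (hg : qpK i *ᵥ g = 0) : qK i *ᵥ (gradK i *ᵥ g) = 0 := by
  have hlam : (domT i.hN i.D i.hk).InGauge (fun x => g (chartY i x)) := (inGauge_iff_qpK_mulVec_eq_zero i g).2 hg
  have hgrad : gradK i *ᵥ g = LatticeFieldCalculus.grad i.cf (fun x => g (chartY i x)) := by
    have h := gradK_mulVec_chart i (fun x => g (chartY i x))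
    simpa only [Equiv.apply_symm_apply] using h
  rw [qK_mulVec_eq_zero_iff, hgrad]
  exact (domT i.hN i.D i.hk).constr_zero_grad hlam i.cf

/-- ★ **`Q(1)D₁λ = 0` for `Q′(1)λ = 0`** at def-Y's letters (`M_N(ℂ)` fibre read entrywise).
[cite: Balaban1984PropagatorsII, p.227 («Because Q′λ′ = 0, hence QA^{λ′} = QA − ∂₁Q′λ′ = QA»); Balaban1985BackgroundPropagators, (3.12)–(3.14) p.393, p.395 («if U = 1»)] -/
theorem QY_gradY_one_of_QpY {Λ : SiteY i → Matrix (Fin N) (Fin N) ℂ} (hQ : QpY i (parSymY i) (fun _ _ => 1) Λ = 0) :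
    QY i (parBY i) (fun _ _ => 1) (gradY i (fun _ _ => 1) Λ) = 0 := by
  have hq : ∀ a b : Fin N, qpK i *ᵥ (fun z => (Λ z a b).re) = 0 ∧ qpK i *ᵥ (fun z => (Λ z a b).im) = 0 := by
    intro a b
    rw [QpY_one i (parSymY_one i)] at hQ
    exact ⟨by rw [← re_liftMatY_apply, hQ]; funext y; simp, by rw [← im_liftMatY_apply, hQ]; funext y; simp⟩
  rw [QY_one i (parBY_one i), gradY_one]
  refine eq_zero_of_entries (fun a b y => ?_) (fun a b y => ?_)
  · have h := congrFun (re_liftMatY_apply (qK i) (liftMatY (Matrix (Fin N) (Fin N) ℂ) (gradK i) Λ) a b) y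
    rw [h, re_liftMatY_apply, qK_gradK_mulVec_of_qpK i (hq a b).1, Pi.zero_apply]
  · have h := congrFun (im_liftMatY_apply (qK i) (liftMatY (Matrix (Fin N) (Fin N) ℂ) (gradK i) Λ) a b) y
    rw [h, im_liftMatY_apply, qK_gradK_mulVec_of_qpK i (hq a b).2, Pi.zero_apply]

/-- `∂₁D₁Λ = 0` (flat curl of a flat gradient). [cite: Balaban1985BackgroundPropagators, (3.3)–(3.4) pp.390–391, (3.7) p.391; Balaban1984PropagatorsI, (1.4) p.18] -/
theorem curlY_gradY_one (Λ : SiteY i → Matrix (Fin N) (Fin N) ℂ) :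
    curlY i (fun _ _ => 1) (gradY i (fun _ _ => 1) Λ) = 0 := by
  have h := OpsYCurlGrad.curlY_comp_gradY_eq_zero_of_holY i (fun _ _ => (1 : (Matrix (Fin N) (Fin N) ℂ)ˣ)) (holY_one i)
  have h' := LinearMap.congr_fun h Λ
  simpa only [LinearMap.comp_apply, LinearMap.zero_apply] using h'

/-- ★ **`R_□(1)` FIXES `D*₁D₁λ`** for a gauge function `λ` with `Q′(1)λ = 0` supported in the cube site set `D` (any idempotent block cut `P`):
`D*₁D₁λ = c_f²Δ′_a(1)λ` (g22), `G′_□(1)Δ′_a(1)λ = λ` (g22, def-Y's Dirichlet identity), so `Q′G′_□(D*₁D₁λ) = c_f²Q′λ = 0` and def-Y's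
`RlocY_apply_of_P_QpY_GsqY_eq_zero` applies — [4]'s «R is the projection onto ΔN(Q′)» for the LOCAL projection.
[cite: Balaban1984PropagatorsII, (2.10)–(2.12) p.225; Balaban1985BackgroundPropagators, (3.25) p.394, pp.408–409 (G′_□), (3.105) p.414] -/
theorem RlocY_one_divY_gradY_of_support (D : Finset (SiteY i)) {P : Module.End ℂ (BlkY i → Matrix (Fin N) (Fin N) ℂ)} (hP : P * P = P)
    {Λ : SiteY i → Matrix (Fin N) (Fin N) ℂ} (hQ : QpY i (parSymY i) (fun _ _ => 1) Λ = 0) (hsupp : cubeProjY i D Λ = Λ) :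
    RlocY i (parSymY i) D P (fun _ _ => 1) (divY i (fun _ _ => 1) (gradY i (fun _ _ => 1) Λ))
      = divY i (fun _ _ => 1) (gradY i (fun _ _ => 1) Λ) := by
  refine RlocY_apply_of_P_QpY_GsqY_eq_zero i (parSymY i) D hP _ ?_
  rw [divY_gradY_one_eq_smul_deltaPrimeAY i hQ, map_smul, GsqY_one_deltaPrimeAY_apply_of_support i D hsupp, map_smul, hQ, smul_zero,
    map_zero]

/-! ## §2 The divergence bound `‖D*₁B‖²₁ ≤ 4(d+1)c_f²·⟨B,B⟩₁` -/

section Entries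

variable {S : Type} [Fintype S]

/-- the weight-1 trace norm as the sum of the squares of the real coordinates of the entries. [cite: Balaban1985BackgroundPropagators, p.393 (scalar products), bookkeeping] -/
theorem trIP_one_self_eq_sum_entries (Ψ : S → Matrix (Fin N) (Fin N) ℂ) :
    trIP (fun _ => (1 : ℝ)) Ψ Ψ = ∑ a : Fin N, ∑ b : Fin N, ((∑ s, (Ψ s a b).re ^ 2) + ∑ s, (Ψ s a b).im ^ 2) := by
  unfold trIP
  simp only [one_mul]
  rw [Finset.sum_comm]
  refine Finset.sum_congr rfl fun a _ => ?_
  rw [Finset.sum_comm]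
  refine Finset.sum_congr rfl fun b _ => ?_
  rw [← Finset.sum_add_distrib]
  refine Finset.sum_congr rfl fun s _ => ?_
  rw [Complex.star_def, Complex.mul_re, Complex.conj_re, Complex.conj_im]
  ring

end Entries

/-- (real kernels) `Σ_z ((divK·v)(z))² ≤ 4(d+1)c_f²·Σ_x v(x)²` — C1's `‖∂*A‖² ≤ 4d·c²‖A‖²` through def-Y's chart.
[cite: Balaban1984PropagatorsII, (2.8) p.224; Balaban1985BackgroundPropagators, (3.8) p.392] -/
theorem sum_sq_divK_mulVec_le (v : FBondY i → ℝ) :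
    ∑ z, (divK i *ᵥ v) z ^ 2 ≤ 4 * ((d + 1 : ℕ) : ℝ) * i.cf ^ 2 * ∑ x, v x ^ 2 := by
  have h1 : ∑ z, (divK i *ᵥ v) z ^ 2 = ∑ x, (onFun (dsE (P := PV d ℓ i.m i.K hd hL) i.cf) v x) ^ 2 := by
    rw [divK_mulVec]
    exact Fintype.sum_equiv (boxEquiv i.hN).symm _ _ (fun z => rfl)
  have h2 : ∑ x, (onFun (dsE (P := PV d ℓ i.m i.K hd hL) i.cf) v x) ^ 2 = ‖dsE (P := PV d ℓ i.m i.K hd hL) i.cf (WithLp.toLp 2 v)‖ ^ 2 := by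
    rw [normSq_eq_sum_sq]
    rfl
  have h3 : ‖(WithLp.toLp 2 v : EuclideanSpace ℝ (FBondY i))‖ ^ 2 = ∑ x, v x ^ 2 := by
    rw [normSq_eq_sum_sq]
  have h4 := normSq_dsE_le (P := PV d ℓ i.m i.K hd hL) i.cf (WithLp.toLp 2 v)
  rw [h1, h2, ← h3]
  exact h4

/-- ★ **`‖D*₁B‖²₁ ≤ 4(d+1)c_f²·⟨B,B⟩₁`** for every `M_N(ℂ)`-valued bond field at def-Y's letters (entrywise over the real kernel `divK`).
[cite: Balaban1985BackgroundPropagators, (3.8) p.392, p.395 («if U = 1»); Balaban1984PropagatorsII, (2.8) p.224] -/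
theorem trIP_divY_one_self_le (B : FBondY i → Matrix (Fin N) (Fin N) ℂ) :
    trIP (fun _ => (1 : ℝ)) (divY i (fun _ _ => 1) B) (divY i (fun _ _ => 1) B) ≤ 4 * ((d + 1 : ℕ) : ℝ) * i.cf ^ 2 * trIP (fun _ => (1 : ℝ)) B B := by
  rw [divY_one, trIP_one_self_eq_sum_entries, trIP_one_self_eq_sum_entries, Finset.mul_sum]
  refine Finset.sum_le_sum fun a _ => ?_
  rw [Finset.mul_sum]
  refine Finset.sum_le_sum fun b _ => ?_
  have hre : (fun z => (liftMatY (Matrix (Fin N) (Fin N) ℂ) (divK i) B z a b).re ^ 2) = fun z => ((divK i *ᵥ fun x => (B x a b).re) z) ^ 2 := by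
    funext z; rw [← re_liftMatY_apply]
  have him : (fun z => (liftMatY (Matrix (Fin N) (Fin N) ℂ) (divK i) B z a b).im ^ 2) = fun z => ((divK i *ᵥ fun x => (B x a b).im) z) ^ 2 := by
    funext z; rw [← im_liftMatY_apply]
  rw [show (∑ z, (liftMatY (Matrix (Fin N) (Fin N) ℂ) (divK i) B z a b).re ^ 2) = ∑ z, ((divK i *ᵥ fun x => (B x a b).re) z) ^ 2 from
      Finset.sum_congr rfl fun z _ => congrFun hre z,
    show (∑ z, (liftMatY (Matrix (Fin N) (Fin N) ℂ) (divK i) B z a b).im ^ 2) = ∑ z, ((divK i *ᵥ fun x => (B x a b).im) z) ^ 2 from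
      Finset.sum_congr rfl fun z _ => congrFun him z, mul_add]
  exact add_le_add (sum_sq_divK_mulVec_le i _) (sum_sq_divK_mulVec_le i _)

/-! ## §3 ★★★ The local reduction: `m_□` from three local letters -/

/-- from `X² ≤ n·Y` and the Poincaré letter `π·n² ≤ X²`: `X² ≤ π⁻¹Y²` (the algebra of C1's `normSq_dE_le_of_poincare`). [cite: Balaban1984PropagatorsII, (2.11) p.225; folklore] -/
private theorem sq_le_of_poincare {X Y n π : ℝ} (hπ : 0 < π) (h1 : X ^ 2 ≤ n * Y) (hP : π * n ^ 2 ≤ X ^ 2) :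
    X ^ 2 ≤ π⁻¹ * Y ^ 2 := by
  have h2 : (X ^ 2) ^ 2 ≤ n ^ 2 * Y ^ 2 := by
    rw [← mul_pow]; exact pow_le_pow_left₀ (sq_nonneg _) h1 2
  have h3 : n ^ 2 ≤ π⁻¹ * X ^ 2 := by
    rw [← div_eq_inv_mul, le_div_iff₀ hπ, mul_comm]; exact hP
  have h4 : (X ^ 2) ^ 2 ≤ π⁻¹ * X ^ 2 * Y ^ 2 := h2.trans (mul_le_mul_of_nonneg_right h3 (sq_nonneg _))
  by_cases h0 : X ^ 2 = 0
  · rw [h0]; positivity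
  · have hpos : 0 < X ^ 2 := lt_of_le_of_ne (sq_nonneg _) (Ne.symm h0)
    rw [pow_two (X ^ 2), mul_assoc] at h4
    exact le_of_mul_le_mul_left (by linarith [h4]) hpos

/-- from `x² ≤ y·x` (`x, y ≥ 0`): `x ≤ y` — the contraction step `‖R_□f‖² = ⟨f, R_□f⟩ ≤ ‖f‖‖R_□f‖`. [folklore] -/
private theorem le_of_sq_le_mul {x y : ℝ} (hx : 0 ≤ x) (hy : 0 ≤ y) (h : x ^ 2 ≤ y * x) : x ≤ y := by
  by_cases h0 : x = 0
  · rw [h0]; exact hy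
  · have hpos : 0 < x := lt_of_le_of_ne hx (Ne.symm h0)
    rw [pow_two] at h
    exact le_of_mul_le_mul_right h hpos

/-- ★★★ **THE LOCAL REDUCTION — `m_□` FROM THREE LOCAL LETTERS, for one configuration.**  At def-Y's letters, `U = 1`, a cube site set `D`, a 0∕1 block cut
`χP`: if `A = B + D₁λ` with `Q′(1)λ = 0` and `λ` supported in `D` (`P_Dλ = λ`), a Lemma-2.4-shaped bound `κ·⟨B,B⟩₁ ≤ ‖∂₁B‖²₁ + ‖Q(1)B‖²_w` for THIS `B` and a
(2.11)-shaped bound `π·⟨λ,λ⟩₁ ≤ ⟨D₁λ, D₁λ⟩₁` for THIS `λ` (`κ, π > 0`), then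
**`(2∕κ + (4∕π)(1 + 4(d+1)c_f²∕κ))⁻¹ · ⟨A,A⟩₁ ≤ ⟨A, Δ_{a,□}(1)A⟩₁`**.  The mechanism is [4]'s: `∂₁A = ∂₁B`, `Q(1)A = Q(1)B`, `R_□D*₁A = R_□D*₁B + D*₁D₁λ`
(`R_□` fixes `D*₁D₁λ`), `‖R_□f‖ ≤ ‖f‖`, `‖D*₁B‖² ≤ 4(d+1)c_f²‖B‖²`, `‖D₁λ‖² = ⟨λ, D*₁D₁λ⟩ ≤ π^{−1∕2}‖D₁λ‖‖D*₁D₁λ‖`, then C1's norm arithmetic in the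
orthonormal coordinates `realify311`. [cite: Balaban1984PropagatorsII, (2.19) p.226, (2.11) p.225, Lemma 2.4 (2.128) p.245, (2.121) p.244, p.227; Balaban1985BackgroundPropagators, Thm 3.11 proof p.416, pp.408–409 (G_□), (3.26) p.395] -/
theorem coer_trIP_deltaALocY_one_of_letters (D : Finset (SiteY i)) {χP : BlkY i → ℝ} (hχP : ∀ y, χP y = 0 ∨ χP y = 1) {κ π : ℝ}
    (hκ : 0 < κ) (hπ : 0 < π) {A B : FBondY i → Matrix (Fin N) (Fin N) ℂ} {Λ : SiteY i → Matrix (Fin N) (Fin N) ℂ}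
    (hA : A = B + gradY i (fun _ _ => 1) Λ) (hQ : QpY i (parSymY i) (fun _ _ => 1) Λ = 0) (hsupp : cubeProjY i D Λ = Λ)
    (hL24 : κ * trIP (fun _ => (1 : ℝ)) B B ≤
      trIP (fun _ => (1 : ℝ)) (curlY i (fun _ _ => 1) B) (curlY i (fun _ _ => 1) B) + trIP i.w (QY i (parBY i) (fun _ _ => 1) B) (QY i (parBY i) (fun _ _ => 1) B))
    (hP : π * trIP (fun _ => (1 : ℝ)) Λ Λ ≤ trIP (fun _ => (1 : ℝ)) (gradY i (fun _ _ => 1) Λ) (gradY i (fun _ _ => 1) Λ)) :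
    (2 / κ + 4 / π * (1 + 4 * ((d + 1 : ℕ) : ℝ) * i.cf ^ 2 / κ))⁻¹ * trIP (fun _ => (1 : ℝ)) A A ≤
      trIP (fun _ => (1 : ℝ)) A (deltaALocY i (parSymY i) (parBY i) D (cutMulY χP) (fun _ _ => 1 : CfgY (Matrix (Fin N) (Fin N) ℂ) i) A) := by
  have hG1 : (⊥ : Subgroup (Matrix (Fin N) (Fin N) ℂ)ˣ) ≤ B7Prop2Explicit.unitaryUnits (Matrix (Fin N) (Fin N) ℂ) := bot_le
  have hw1 : ∀ _ : FBondY i, (0 : ℝ) < 1 := fun _ => one_pos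
  have hw1' : ∀ _ : SiteY i, (0 : ℝ) < 1 := fun _ => one_pos
  -- orthonormal coordinates
  set e := realify311 (S := FBondY i) (n := Fin N) (fun _ => (1 : ℝ)) hw1 with he
  set e' := realify311 (S := SiteY i) (n := Fin N) (fun _ => (1 : ℝ)) hw1' with he'
  have hnorm : ∀ X : FBondY i → Matrix (Fin N) (Fin N) ℂ, ‖e X‖ ^ 2 = trIP (fun _ => (1 : ℝ)) X X := fun X => norm_sq_realify311 X
  have hnorm' : ∀ X : SiteY i → Matrix (Fin N) (Fin N) ℂ, ‖e' X‖ ^ 2 = trIP (fun _ => (1 : ℝ)) X X := fun X => norm_sq_realify311 X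
  have hinner' : ∀ X Y : SiteY i → Matrix (Fin N) (Fin N) ℂ, ⟪e' X, e' Y⟫_ℝ = trIP (fun _ => (1 : ℝ)) X Y := fun X Y => inner_realify311 X Y
  -- the letters of the mechanism
  set g := gradY i (fun _ _ => 1) Λ with hg
  set R := RlocY i (parSymY i) D (cutMulY (𝔸 := Matrix (Fin N) (Fin N) ℂ) χP) (fun _ _ => 1) with hR
  set dv := divY (𝔸 := Matrix (Fin N) (Fin N) ℂ) i (fun _ _ => 1) with hdv
  have hcurl : curlY i (fun _ _ => 1) A = curlY i (fun _ _ => 1) B := by rw [hA, map_add, curlY_gradY_one, add_zero]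
  have hQA : QY i (parBY i) (fun _ _ => 1) A = QY i (parBY i) (fun _ _ => 1) B := by rw [hA, map_add, QY_gradY_one_of_QpY i hQ, add_zero]
  have hPcut : cutMulY (𝔸 := Matrix (Fin N) (Fin N) ℂ) χP * cutMulY χP = cutMulY χP := cutMulY_mul_self_of_zero_one hχP
  have hfix : R (dv g) = dv g := RlocY_one_divY_gradY_of_support i D hPcut hQ hsupp
  have hr : R (dv A) = R (dv B) + dv g := by rw [hA, map_add, map_add, hfix]
  -- contraction of `R_□`: `‖e'(R f)‖ ≤ ‖e' f‖`
  have hRself : ∀ f, trIP (fun _ => (1 : ℝ)) f (R f) = trIP (fun _ => (1 : ℝ)) (R f) (R f) :=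
    fun f => trIP_RlocY_parSymY_self i hG1 (cfg_one_mem_bot i) D hχP f
  have hRle : ∀ f, ‖e' (R f)‖ ≤ ‖e' f‖ := by
    intro f
    refine le_of_sq_le_mul (norm_nonneg _) (norm_nonneg _) ?_
    rw [hnorm', ← hRself, ← hinner']
    exact real_inner_le_norm _ _
  -- the form as three squares
  have hform : trIP (fun _ => (1 : ℝ)) A (deltaALocY i (parSymY i) (parBY i) D (cutMulY χP) (fun _ _ => 1) A)
      = (trIP (fun _ => (1 : ℝ)) (curlY i (fun _ _ => 1) B) (curlY i (fun _ _ => 1) B)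
          + trIP i.w (QY i (parBY i) (fun _ _ => 1) B) (QY i (parBY i) (fun _ _ => 1) B)) + ‖e' (R (dv A))‖ ^ 2 := by
    rw [trIP_deltaALocY_parSymY_eq i hG1 (cfg_one_mem_bot i) D (cutMulY χP) A,
      trIP_hessY_eq_curl_of_flat i (cfg_one_mem_unitary i) (holY_one i) A, hcurl, hQA, hnorm', ← hRself]
    ring
  have ht0 : 0 ≤ trIP (fun _ => (1 : ℝ)) (curlY i (fun _ _ => 1) B) (curlY i (fun _ _ => 1) B)
      + trIP i.w (QY i (parBY i) (fun _ _ => 1) B) (QY i (parBY i) (fun _ _ => 1) B) :=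
    add_nonneg (trIP_self_nonneg _ (fun _ => one_pos) _) (trIP_self_nonneg i.w i.hw _)
  -- `‖e'(R D* B)‖² ≤ 4(d+1)c_f²‖e B‖²`
  have hrB : ‖e' (R (dv B))‖ ^ 2 ≤ 4 * ((d + 1 : ℕ) : ℝ) * i.cf ^ 2 * ‖e B‖ ^ 2 := by
    calc ‖e' (R (dv B))‖ ^ 2 ≤ ‖e' (dv B)‖ ^ 2 := pow_le_pow_left₀ (norm_nonneg _) (hRle _) 2
      _ ≤ 4 * ((d + 1 : ℕ) : ℝ) * i.cf ^ 2 * ‖e B‖ ^ 2 := by rw [hnorm', hnorm]; exact trIP_divY_one_self_le i B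
  -- `‖e g‖² ≤ π⁻¹‖e'(D* g)‖²`
  have hU1 := cfg_one_mem_unitary (N := N) i
  have hadj : trIP (fun _ => (1 : ℝ)) g g = trIP (fun _ => (1 : ℝ)) Λ (dv g) := isAdjTr_gradY_divY i (fun _ _ => 1) hU1 Λ g
  have hgsq : ‖e g‖ ^ 2 ≤ π⁻¹ * ‖e' (dv g)‖ ^ 2 := by
    refine sq_le_of_poincare (n := ‖e' Λ‖) hπ ?_ ?_
    · rw [hnorm, hadj, ← hinner']; exact real_inner_le_norm _ _
    · rw [hnorm', hnorm]; exact hP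
  -- C1's norm arithmetic
  have hA' : e A = e B + e g := by rw [hA, map_add]
  have hB' : κ * ‖e B‖ ^ 2 ≤ trIP (fun _ => (1 : ℝ)) (curlY i (fun _ _ => 1) B) (curlY i (fun _ _ => 1) B)
      + trIP i.w (QY i (parBY i) (fun _ _ => 1) B) (QY i (parBY i) (fun _ _ => 1) B) := by rw [hnorm]; exact hL24
  have hr' : e' (R (dv A)) = e' (R (dv B)) + e' (dv g) := by rw [hr, map_add]
  have hCd : (0 : ℝ) ≤ 4 * ((d + 1 : ℕ) : ℝ) * i.cf ^ 2 := by positivity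
  have hmain := coercive_of_gauge_letters_abstract hκ hπ hCd hA' ht0 hB' (le_of_eq hform.symm) hr' hrB hgsq
  have hpos : 0 < 2 / κ + 4 / π * (1 + 4 * ((d + 1 : ℕ) : ℝ) * i.cf ^ 2 / κ) := by positivity
  rw [inv_mul_le_iff₀ hpos, ← hnorm]
  exact hmain

/-- ★★ **`m_□` FROM THREE LOCAL LETTERS ON CLASSES.**  A class `𝒯` of bond fields with the Lemma-2.4-shaped letter, a class `𝒩` of gauge functions with
`Q′(1)λ = 0`, support in `D` and the (2.11)-shaped letter, and the decomposition `A = B + D₁λ` (`B ∈ 𝒯`, `λ ∈ 𝒩`) for the given `A` ⟹ the explicit bound.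
[cite: Balaban1984PropagatorsII, (2.19) p.226, (2.11) p.225, Lemma 2.4 (2.128) p.245, (2.121) p.244; Balaban1985BackgroundPropagators, Thm 3.11 proof p.416, pp.408–409] -/
theorem coer_trIP_deltaALocY_one_of_classes (D : Finset (SiteY i)) {χP : BlkY i → ℝ} (hχP : ∀ y, χP y = 0 ∨ χP y = 1) {κ π : ℝ}
    (hκ : 0 < κ) (hπ : 0 < π) (𝒯 : Set (FBondY i → Matrix (Fin N) (Fin N) ℂ)) (𝒩 : Set (SiteY i → Matrix (Fin N) (Fin N) ℂ))
    (hL24 : ∀ B ∈ 𝒯, κ * trIP (fun _ => (1 : ℝ)) B B ≤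
      trIP (fun _ => (1 : ℝ)) (curlY i (fun _ _ => 1) B) (curlY i (fun _ _ => 1) B) + trIP i.w (QY i (parBY i) (fun _ _ => 1) B) (QY i (parBY i) (fun _ _ => 1) B))
    (h𝒩 : ∀ Λ ∈ 𝒩, QpY i (parSymY i) (fun _ _ => 1) Λ = 0 ∧ cubeProjY i D Λ = Λ ∧
      π * trIP (fun _ => (1 : ℝ)) Λ Λ ≤ trIP (fun _ => (1 : ℝ)) (gradY i (fun _ _ => 1) Λ) (gradY i (fun _ _ => 1) Λ))
    {A : FBondY i → Matrix (Fin N) (Fin N) ℂ} (hdec : ∃ B ∈ 𝒯, ∃ Λ ∈ 𝒩, A = B + gradY i (fun _ _ => 1) Λ) :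
    (2 / κ + 4 / π * (1 + 4 * ((d + 1 : ℕ) : ℝ) * i.cf ^ 2 / κ))⁻¹ * trIP (fun _ => (1 : ℝ)) A A ≤
      trIP (fun _ => (1 : ℝ)) A (deltaALocY i (parSymY i) (parBY i) D (cutMulY χP) (fun _ _ => 1 : CfgY (Matrix (Fin N) (Fin N) ℂ) i) A) := by
  obtain ⟨B, hB, Λ, hΛ, hA⟩ := hdec
  obtain ⟨hQ, hsupp, hP⟩ := h𝒩 Λ hΛ
  exact coer_trIP_deltaALocY_one_of_letters i D hχP hκ hπ hA hQ hsupp (hL24 B hB) hP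

/-- the weight-1 trace norm splits along a 0∕1 bond cut: `⟨Ψ,Ψ⟩₁ = ⟨M_χΨ, M_χΨ⟩₁ + ⟨M_{1−χ}Ψ, M_{1−χ}Ψ⟩₁`. [cite: Balaban1985BackgroundPropagators, (3.79) p.406, p.393 (scalar products), bookkeeping] -/
theorem trIP_one_eq_cut_add_compl {χ : FBondY i → ℝ} (hχ : ∀ b, χ b = 0 ∨ χ b = 1) (Ψ : FBondY i → Matrix (Fin N) (Fin N) ℂ) :
    trIP (fun _ => (1 : ℝ)) Ψ Ψ
      = trIP (fun _ => (1 : ℝ)) (cutMulY χ Ψ) (cutMulY χ Ψ)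
        + trIP (fun _ => (1 : ℝ)) (cutMulY (fun z => 1 - χ z) Ψ) (cutMulY (fun z => 1 - χ z) Ψ) := by
  have hχχ : (fun z => χ z * χ z) = χ := funext fun z => by rcases hχ z with h | h <;> simp [h]
  have hcc : (fun z => (1 - χ z) * (1 - χ z)) = fun z => 1 - χ z := funext fun z => by rcases hχ z with h | h <;> simp [h]
  rw [trIP_cutMulY_right_gen, ← Module.End.mul_apply, cutMulY_mul, hχχ, trIP_cutMulY_right_gen (h := fun z => 1 - χ z), ← Module.End.mul_apply,
    cutMulY_mul, hcc, trIP_comm (fun _ => (1 : ℝ)) (cutMulY χ Ψ), trIP_comm (fun _ => (1 : ℝ)) (cutMulY (fun z => 1 - χ z) Ψ), ← trIP_add_right,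
    cutMulY_add_compl]

/-- ★★★ **THE CENTRE NUMBER OF THE ROW-17 LOCAL ROAD FROM THREE LOCAL LETTERS**: for 0∕1 cuts `χP`, `χ`, classes `𝒯`, `𝒩` with the two letters as above, and
the decomposition available for every cut field `M_χΨ`, the PADDED local operator satisfies
**`min 1 γ · ⟨Ψ,Ψ⟩₁ ≤ ⟨Ψ, padDeltaALocY i parSymY parBY D (cutMulY χP) (cutMulY χ) 1 Ψ⟩₁` for every `Ψ`**, `γ = (2∕κ + (4∕π)(1 + 4(d+1)c_f²∕κ))⁻¹` —
VERBATIM the `hco` binder of `…N06Row17LocalClauseOnReg335OfL5Letters.posDefTr_padDeltaALocY_of_L5_of_regYP335` with `m := min 1 γ`.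
[cite: Balaban1985BackgroundPropagators, Thm 3.11 proof p.416 («G_□(1) is positive»), Cor. 3.6 p.408, pp.408–409 (G_□), (3.105) p.414; Balaban1984PropagatorsII, p.226 («bounded from below by a positive constant»), (2.19) p.226] -/
theorem coer_trIP_padDeltaALocY_one_of_classes (D : Finset (SiteY i)) {χP : BlkY i → ℝ} (hχP : ∀ y, χP y = 0 ∨ χP y = 1)
    {χ : FBondY i → ℝ} (hχ : ∀ b, χ b = 0 ∨ χ b = 1) {κ π : ℝ} (hκ : 0 < κ) (hπ : 0 < π)
    (𝒯 : Set (FBondY i → Matrix (Fin N) (Fin N) ℂ)) (𝒩 : Set (SiteY i → Matrix (Fin N) (Fin N) ℂ))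
    (hL24 : ∀ B ∈ 𝒯, κ * trIP (fun _ => (1 : ℝ)) B B ≤
      trIP (fun _ => (1 : ℝ)) (curlY i (fun _ _ => 1) B) (curlY i (fun _ _ => 1) B) + trIP i.w (QY i (parBY i) (fun _ _ => 1) B) (QY i (parBY i) (fun _ _ => 1) B))
    (h𝒩 : ∀ Λ ∈ 𝒩, QpY i (parSymY i) (fun _ _ => 1) Λ = 0 ∧ cubeProjY i D Λ = Λ ∧
      π * trIP (fun _ => (1 : ℝ)) Λ Λ ≤ trIP (fun _ => (1 : ℝ)) (gradY i (fun _ _ => 1) Λ) (gradY i (fun _ _ => 1) Λ))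
    (hdec : ∀ Ψ : FBondY i → Matrix (Fin N) (Fin N) ℂ, ∃ B ∈ 𝒯, ∃ Λ ∈ 𝒩, cutMulY χ Ψ = B + gradY i (fun _ _ => 1) Λ)
    (Ψ : FBondY i → Matrix (Fin N) (Fin N) ℂ) :
    min 1 (2 / κ + 4 / π * (1 + 4 * ((d + 1 : ℕ) : ℝ) * i.cf ^ 2 / κ))⁻¹ * trIP (fun _ => (1 : ℝ)) Ψ Ψ ≤
      trIP (fun _ => (1 : ℝ)) Ψ
        (padDeltaALocY i (parSymY i) (parBY i) D (cutMulY χP) (cutMulY χ) (fun _ _ => 1 : CfgY (Matrix (Fin N) (Fin N) ℂ) i) Ψ) := by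
  rw [OpsYDeltaALocal.padDeltaALocY_eq_dirPadY, trIP_dirPadY_cutMulY_eq (fun _ => (1 : ℝ)) hχ, trIP_one_eq_cut_add_compl i hχ Ψ, mul_add]
  have h1 := coer_trIP_deltaALocY_one_of_classes i D hχP hκ hπ 𝒯 𝒩 hL24 h𝒩 (hdec Ψ)
  have hX := trIP_self_nonneg (fun _ => (1 : ℝ)) (fun _ => one_pos) (cutMulY χ Ψ)
  have hY := trIP_self_nonneg (fun _ => (1 : ℝ)) (fun _ => one_pos) (cutMulY (fun z => 1 - χ z) Ψ)
  refine add_le_add (le_trans (mul_le_mul_of_nonneg_right (min_le_right _ _) hX) h1) ?_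
  calc min 1 (2 / κ + 4 / π * (1 + 4 * ((d + 1 : ℕ) : ℝ) * i.cf ^ 2 / κ))⁻¹ *
          trIP (fun _ => (1 : ℝ)) (cutMulY (fun z => 1 - χ z) Ψ) (cutMulY (fun z => 1 - χ z) Ψ)
        ≤ 1 * trIP (fun _ => (1 : ℝ)) (cutMulY (fun z => 1 - χ z) Ψ) (cutMulY (fun z => 1 - χ z) Ψ) :=
          mul_le_mul_of_nonneg_right (min_le_left _ _) hY
    _ = _ := one_mul _

end Summit.QuantumFields.YangMills.BalabanUVNodes.N06Row17LocalCentreCoercive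

end
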